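import Summits.HubbardSuperconductivity.HubbardLadder.Bounds.SpinCorrelationEtaLineEuclid
import Literature.MathematicalPhysics.QuantumLattice.HubbardInteractionClassDecaySharp
import Mathlib.Order.LiminfLimsup
import HarnessLib
import HarnessLib.Audit

/-!
# Hubbard ladder — Bounds: the sharp Koma–Tasaki ceilings are UNIFORM over the whole
# interaction class `H_Λ(t,U) - μN + P`, `P` any charge-conserving Hermitian term
# (bounds.tex Thm 10⁷; Koma–Tasaki eq. (1))

HONEST FRAMING (cell pub-hubbard): ladder R1–R4 with certified numbers; no claim on H/H₀. These
are bounds for a MODEL CLASS — no materials claim. The class: the grand-canonical Hubbard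
Hamiltonian `hubbardTorusWith d L t U μ` (all real `t, U, μ`) PLUS an arbitrary Hermitian
operator `P` on Fock space that is invariant under every site gauge transformation
`G_ψ = exp[-∑_u ψ_u n_u]` (`siteGauge ψ * P * siteGauge (-ψ) = P` for all real `ψ`;
equivalently `[P, n_u] = 0` for every site `u`). It contains every real function of the
occupation numbers (`densityInteraction W`: extended / long-range / screened-Coulomb / random
density–density interactions of either sign, site-dependent potentials, Zeeman fields) and the
on-site and exchange spin couplings; it does NOT contain charge-moving terms (longer-range or
complex hoppings, pair hopping, correlated hopping). Koma–Tasaki state their theorem for this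
class (their eq. (1) and the paragraph after it); the tree's formalisation (`hamiltonianWith`)
had the standard interaction `U ∑ n_{u↑}n_{u↓} - μN` only.

What this file files (all PROVED, `_holds`), with constants that do NOT depend on `P`:

* `ClassMultiFermionEtaLineEuclid` — square lattice `(ℤ/Lℤ)²`, every `n`-fermion local product
  with steps in `{0, ±e₁, ±e₂}` and any spins, `β > 0`, `β|t| < n²/π`: ONE pair `f > 1/4`, `C`
  such that `|⟨(P_x)† P'_y⟩_{β,L; H+P}| ≤ C (dist(x,y)+1)^{-f}` for ALL `L`, ALL admissible `P`,
  all `x, y`.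
* `ClassMultiFermionEtaLineSharp` — the thermodynamic-limit form of the sharp exponent
  `η_n(T) ≥ n²T/(4π|t|)`: for `ε > 0` ONE radius `R` such that for EVERY sequence of admissible
  perturbations `P_L` and every `z ∈ ℤ²` with `|z| ≥ R`,
  `limsup_{L→∞} |⟨(P_0)† P'_z⟩_{β,L+1; H+P_L}| ≤ |z|^{-(1-ε)n²/(4πβ|t|)}`.
* `ClassRingCorrelationLengthLowT` / `ClassRingCorrelationLengthHighT` — the ring `ℤ/Lℤ`:
  `|⟨(P_x)† P'_y⟩_{β,L; H+P}| ≤ e^{n²/(4β|t|)} exp(-n² dist/(16β|t|))` for `n ≤ 8β|t|`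
  (`ξ_n(T) ≤ 16|t|/(n²T)`), and `≤ e^{2n} exp(-(n/2) dist)` for `8β|t| ≤ n`, for ALL admissible `P`.

Reading: the temperature scale of every Koma–Tasaki-type ceiling on `n`-electron (pairing,
quartetting, one-particle) correlations at `T > 0` in `d ≤ 2` is set by the HOPPING alone; no
density interaction of any range, sign or randomness, and no spin coupling, can raise it.

Relation to what the tree already has: the `P = 0` members are the nodes
`MultiFermionEtaLineEuclid`, `MultiFermionEtaLineSharp` (`Bounds/MultiFermionEtaLineEuclid.lean`)
and the ring rows of `Bounds/RingExponentialClustering.lean` (LEAN FILING REQUEST #142); this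
file does not re-file them — its content is the uniformity in `P` (`densityInteraction_zero`
recovers them). Mechanism (Literature `HubbardInteractionClassDecaySharp`, this seat): `G_ψ` is
a function of the number operators, so `G(H+P)G⁻¹ + h.c. = [G H G⁻¹ + h.c.] + 2P` and the
model-independent Gibbs-state bound `norm_gibbsState_le_of_gauge` applies with the SAME
perturbation norm as for `H`; the profile steps (`le_rpow_euclid_of_apriori_flat`,
`le_exp_ring_of_apriori_flat`) consume only that a priori bound.

NOT claimed: optimality of any constant; charge-moving perturbations; the magnetic (`S⁺S⁻`)
twins for the class (same argument with the sign gauge; not formalised); `T = 0`.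

References (keys of `lean/references.bib`): KomaTasakiPRL1992 (eq. (1) and the paragraph after
it; eq. (7); eqs. (5)–(13); footnote [10]; Theorem, both clauses); McBryanSpencer1977.
Companion text: `pub-hubbard/paper/bounds.tex` Thm 10⁷; table `pub-hubbard-bounds/BOUNDS.md`
(row T8¹³); `pub-hubbard-bounds/EXTREMISERS.md` §5n.
-/

noncomputable section

namespace Summit.HubbardSuperconductivity.HubbardLadder.Bounds

open Matrix Finset NormedSpace
open Literature.MathematicalPhysics.QuantumLattice Literature.Probability.LatticeModels
  Literature.Barriers.HubbardSuperconductivity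
open scoped Matrix.Norms.L2Operator ComplexOrder

/-! ### Arithmetic of the exponent (as in `MultiFermionEtaLineEuclid`) -/

/-- `b < n²/π` with `b ≥ 0` forces `n ≥ 1`. [folklore] -/
private theorem one_le_of_lt_sq_divC {n : ℕ} {b : ℝ} (hb0 : 0 ≤ b)
    (hb : b < (n : ℝ) ^ 2 / Real.pi) : (1 : ℝ) ≤ n := by
  have hn2 : (0 : ℝ) < (n : ℝ) ^ 2 / Real.pi := lt_of_le_of_lt hb0 hb
  have hn0 : n ≠ 0 := by
    rintro rfl
    simp at hn2
  exact_mod_cast Nat.one_le_iff_ne_zero.2 hn0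

/-- From `b < n²/π`, `b ≥ 0`: an explicit `q ≥ 0` with `f = 2nq - 4πbq² > 1/4`. [folklore] -/
private theorem exists_exponent_gt_quarterC {n : ℕ} {b : ℝ} (hb0 : 0 ≤ b)
    (hb : b < (n : ℝ) ^ 2 / Real.pi) :
    ∃ q : ℝ, 0 ≤ q ∧ 1 / 4 < 2 * n * q - 4 * Real.pi * b * q ^ 2 := by
  have hπ := Real.pi_pos
  have hn : (1 : ℝ) ≤ n := one_le_of_lt_sq_divC hb0 hb
  have hbn : Real.pi * b < (n : ℝ) ^ 2 := by
    have := (lt_div_iff₀ hπ).1 hb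
    linarith
  by_cases hc : 4 * Real.pi * b ≤ n
  · refine ⟨1 / 4, by norm_num, ?_⟩
    nlinarith
  · have hc' : (n : ℝ) < 4 * Real.pi * b := not_le.1 hc
    have hb1 : 0 < b := by
      rcases hb0.eq_or_lt with h | h
      · rw [← h, mul_zero] at hc'; linarith
      · exact h
    refine ⟨n / (4 * Real.pi * b), by positivity, ?_⟩
    have hfval : 2 * (n : ℝ) * (n / (4 * Real.pi * b)) -
        4 * Real.pi * b * (n / (4 * Real.pi * b)) ^ 2 = (n : ℝ) ^ 2 / (4 * Real.pi * b) := by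
      field_simp
      ring
    rw [hfval, div_lt_div_iff₀ (by norm_num) (by positivity)]
    nlinarith

/-! ### Square lattice: the `η = 1/4` line, uniformly over the class -/

/-- **Thm 10⁷ (b), torus form (PROVED below).** On `(ℤ/Lℤ)²`, for every `n`-fermion local
product `P_x = c_{x+δ₁,σ₁} ⋯ c_{x+δ_n,σ_n}`, `P'_y` likewise (steps in `{0, ±e₁, ±e₂}`, any
spins), all real `t, U, μ` and `β > 0` with `β|t| < n²/π`, there are `f > 1/4` and `C` —
depending on `n, β|t|` ONLY — such that for every `L`, every Hermitian `P` commuting with all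
local charges (`siteGauge ψ * P * siteGauge (-ψ) = P` for all `ψ`) and all `x, y`:
`|⟨(P_x)† P'_y⟩_{β,L; H(t,U)-μN+P}| ≤ C (dist(x,y)+1)^{-f}`. kind: support (PROVED). Why it might
fail: it cannot (proved); NOT claimed: charge-moving `P`, optimality. Sources: KomaTasakiPRL1992
eq. (1) (the class), Theorem, eqs. (5)–(13), footnote [10]; McBryanSpencer1977; this cell
bounds.tex Thm 10⁷; tree node `MultiFermionEtaLineEuclid` (the member `P = 0`). -/
@[conjecture] def ClassMultiFermionEtaLineEuclid : Prop :=
  ∀ (n : ℕ) (δ δ' : Fin n → Site 2) (σ σ' : Fin n → Fin 2),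
    (∀ i, δ i ∈ insert (0 : Site 2) unitSteps) → (∀ i, δ' i ∈ insert (0 : Site 2) unitSteps) →
    ∀ (t U μ β : ℝ), 0 < β → β * |t| < (n : ℝ) ^ 2 / Real.pi →
    ∃ f C : ℝ, 1 / 4 < f ∧ ∀ (L : ℕ) [NeZero L]
      (P : Matrix (Finset (Orb (FermionTorus 2 L))) (Finset (Orb (FermionTorus 2 L))) ℂ),
      P.IsHermitian → (∀ ψ : FermionTorus 2 L → ℝ, siteGauge ψ * P * siteGauge (-ψ) = P) →
      ∀ (x y : TorusSite 2 L),
        ‖(hubbardTorusWith 2 L t U μ + P).thermalCorr β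
            (multiFermion δ σ L x)ᴴ (multiFermion δ' σ' L y)‖ ≤
          C * ((torusDist x y : ℝ) + 1) ^ (-f)

/-- **`ClassMultiFermionEtaLineEuclid` holds** (`norm_thermalCorr_multiFermion_le_sharp_add` at the
witness `q` of `exists_exponent_gt_quarterC`; `C = K(q) 5^f` is free of `P`). -/
theorem classMultiFermionEtaLineEuclid_holds : ClassMultiFermionEtaLineEuclid := by
  intro n δ δ' σ σ' hδ hδ' t U μ β hβ hb
  have hb0 : 0 ≤ β * |t| := by positivity
  obtain ⟨q, hq0, hf4⟩ := exists_exponent_gt_quarterC hb0 hb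
  refine ⟨2 * n * q - 4 * Real.pi * (β * |t|) * q ^ 2,
    Real.exp (2 * (β * |t|) *
        (2 * Real.pi * q ^ 2 + 76 * q ^ 2 + 544 * q ^ 4 * Real.exp (2 * q ^ 2))) *
      (5 : ℝ) ^ (2 * n * q - 4 * Real.pi * (β * |t|) * q ^ 2), hf4,
    fun L _ P hP hPg x y => ?_⟩
  rw [mul_assoc]
  exact norm_thermalCorr_multiFermion_le_sharp_add L δ δ' σ σ' hδ hδ' t U μ β q hβ.le hq0
    (by linarith) hP hPg x y

/-! ### Square lattice: the sharp exponent in the thermodynamic limit, uniformly over the class -/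

/-- **Thm 10⁷ (b), thermodynamic-limit form (PROVED below).** For `n ≥ 1`, steps in
`{0, ±e₁, ±e₂}`, any spins, all real `U, μ`, `t ≠ 0`, `β > 0`, `ε > 0` there is a radius `R` —
depending on `n, β|t|, ε` ONLY — such that for EVERY sequence `P_L` of Hermitian operators
commuting with all local charges of `(ℤ/(L+1)ℤ)²` and every `z ∈ ℤ²` with `|z| ≥ R`:
`limsup_{L→∞} |⟨(P_0)† P'_z⟩_{β,L+1; H(t,U)-μN+P_L}| ≤ |z|^{-(1-ε) n²/(4πβ|t|)}` — the sharp
Koma–Tasaki exponent `η_n(T) = n²T/(4π|t|)` for the whole interaction class. kind: support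
(PROVED). Why it might fail: it cannot (proved). Sources: KomaTasakiPRL1992 eq. (1), Theorem,
footnote [10]; McBryanSpencer1977; this cell bounds.tex Thm 10⁷; tree node
`MultiFermionEtaLineSharp` (the member `P = 0`). -/
@[conjecture] def ClassMultiFermionEtaLineSharp : Prop :=
  ∀ (n : ℕ) (δ δ' : Fin n → Site 2) (σ σ' : Fin n → Fin 2),
    (∀ i, δ i ∈ insert (0 : Site 2) unitSteps) → (∀ i, δ' i ∈ insert (0 : Site 2) unitSteps) →
    0 < n → ∀ (t U μ β : ℝ), 0 < |t| → 0 < β → ∀ ε : ℝ, 0 < ε →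
    ∃ R : ℝ,
      ∀ (P : (L : ℕ) → Matrix (Finset (Orb (FermionTorus 2 (L + 1))))
          (Finset (Orb (FermionTorus 2 (L + 1)))) ℂ),
        (∀ L, (P L).IsHermitian) →
        (∀ (L : ℕ) (ψ : FermionTorus 2 (L + 1) → ℝ),
          siteGauge ψ * P L * siteGauge (-ψ) = P L) →
        ∀ z : Fin 2 → ℤ, R ≤ intNorm z →
          Filter.limsup (fun L : ℕ =>
              ‖(hubbardTorusWith 2 (L + 1) t U μ + P L).thermalCorr β
                (multiFermion δ σ (L + 1) (torusSiteOfInt (L + 1) 0))ᴴ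
                (multiFermion δ' σ' (L + 1) (torusSiteOfInt (L + 1) z))‖)
            Filter.atTop ≤ intNorm z ^ (-((1 - ε) * (n : ℝ) ^ 2 / (4 * Real.pi * β * |t|)))

/-- **`ClassMultiFermionEtaLineSharp` holds.** The radius `R` is produced by
`exists_limsup_le_rpow` applied to the (`P`-free) BOUND `K(q*) 5^{f*} (dist+1)^{-f*}` itself,
`q* = n/(4πβ|t|)`, `f* = n²/(4πβ|t|)`; for each admissible sequence `P_L` the correlator is
dominated by that bound (`norm_thermalCorr_multiFermion_le_sharp_add`), so its `limsup` is too
(`Filter.limsup_le_limsup`). -/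
theorem classMultiFermionEtaLineSharp_holds : ClassMultiFermionEtaLineSharp := by
  intro n δ δ' σ σ' hδ hδ' hn t U μ β ht hβ ε hε
  set b : ℝ := β * |t| with hbdef
  have hb0 : 0 < b := mul_pos hβ ht
  have hπ := Real.pi_pos
  have hn1 : (0 : ℝ) < n := by exact_mod_cast hn
  set q : ℝ := n / (4 * Real.pi * b) with hq
  have hq0 : 0 ≤ q := by positivity
  set fs : ℝ := 2 * n * q - 4 * Real.pi * b * q ^ 2 with hfs
  have hfval : fs = (n : ℝ) ^ 2 / (4 * Real.pi * b) := by
    rw [hfs, hq]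
    field_simp
    ring
  have hfpos : 0 < fs := by rw [hfval]; positivity
  have hεf : 0 < ε * fs := by positivity
  set K : ℝ := Real.exp (2 * b *
    (2 * Real.pi * q ^ 2 + 76 * q ^ 2 + 544 * q ^ 4 * Real.exp (2 * q ^ 2))) with hK
  have hK0 : 0 < K := Real.exp_pos _
  -- the `P`-free majorant
  set G : ℕ → (Fin 2 → ℤ) → ℝ := fun L z => K * ((5 : ℝ) ^ fs *
    ((torusDist (torusSiteOfInt (L + 1) 0) (torusSiteOfInt (L + 1) z) : ℝ) + 1) ^ (-fs)) with hG
  have hG0 : ∀ L z, 0 ≤ G L z := fun L z => by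
    simp only [hG]
    exact mul_nonneg hK0.le (mul_nonneg (Real.rpow_nonneg (by norm_num) _)
      (Real.rpow_nonneg (by positivity) _))
  have hGle : ∀ L z, G L z ≤ K * (5 : ℝ) ^ fs := fun L z => by
    simp only [hG]
    rw [← mul_assoc]
    refine mul_le_of_le_one_right (by positivity) ?_
    exact Real.rpow_le_one_of_one_le_of_nonpos (by simp) (by linarith)
  obtain ⟨R, hR⟩ := exists_limsup_le_rpow G K fs (ε * fs) hK0 hfpos hεf hG0 (fun L z => le_rfl)
  refine ⟨R, fun P hP hPg z hz => ?_⟩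
  have hexp : -((1 - ε) * (n : ℝ) ^ 2 / (4 * Real.pi * β * |t|)) = -fs + ε * fs := by
    rw [hfval, hbdef]
    field_simp
    ring
  rw [hexp]
  refine le_trans ?_ (hR z hz)
  refine Filter.limsup_le_limsup (Filter.Eventually.of_forall fun L => ?_)
    (Filter.isCoboundedUnder_le_of_le _ (fun L => norm_nonneg _))
    (Filter.isBoundedUnder_of_eventually_le (a := K * (5 : ℝ) ^ fs)
      (Filter.Eventually.of_forall fun L => hGle L z))
  exact norm_thermalCorr_multiFermion_le_sharp_add (L + 1) δ δ' σ σ' hδ hδ' t U μ β q hβ.le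
    hq0 hfpos.le (hP L) (hPg L) (torusSiteOfInt (L + 1) 0) (torusSiteOfInt (L + 1) z)

/-! ### The ring: explicit correlation lengths, uniformly over the class -/

/-- **Thm 10⁷ (c), low temperature (PROVED below).** On the ring `ℤ/Lℤ`, for every `n`-fermion
local product (`multiFermionD 1`, steps in `{0, ±1}`, any spins), all real `t, U, μ`, `β ≥ 0` with
`n ≤ 8β|t|` (`T ≤ 8|t|/n`), every `L`, every Hermitian `P` commuting with all local charges, all
`x, y`: `|⟨(P_x)† P'_y⟩_{β,L; H(t,U)-μN+P}| ≤ e^{n²/(4β|t|)} exp(-n² dist(x,y)/(16β|t|))` — the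
`n`-particle correlation length is at most `16β|t|/n² = 16|t|/(n²T)` for the whole class (pairs:
`4|t|/T`). kind: support (PROVED). Why it might fail: it cannot (proved). Sources:
KomaTasakiPRL1992 eq. (1), Theorem eq. (4) (one-dimensional clause), eq. (13); this cell
bounds.tex Thm 10⁷; tree `koma_tasaki_1d_holds` and node `RingCorrelationLengthLowT` (`P = 0`). -/
@[conjecture] def ClassRingCorrelationLengthLowT : Prop :=
  ∀ (n : ℕ) (δ δ' : Fin n → Site 1) (σ σ' : Fin n → Fin 2),
    (∀ i j, δ i j = 0 ∨ δ i j = 1 ∨ δ i j = -1) → (∀ i j, δ' i j = 0 ∨ δ' i j = 1 ∨ δ' i j = -1) →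
    ∀ (t U μ β : ℝ), 0 ≤ β → (n : ℝ) ≤ 8 * (β * |t|) →
    ∀ (L : ℕ) [NeZero L]
      (P : Matrix (Finset (Orb (FermionTorus 1 L))) (Finset (Orb (FermionTorus 1 L))) ℂ),
      P.IsHermitian → (∀ ψ : FermionTorus 1 L → ℝ, siteGauge ψ * P * siteGauge (-ψ) = P) →
      ∀ (x y : TorusSite 1 L),
        ‖(hubbardTorusWith 1 L t U μ + P).thermalCorr β
            (multiFermionD 1 δ σ L x)ᴴ (multiFermionD 1 δ' σ' L y)‖ ≤
          Real.exp ((n : ℝ) ^ 2 / (4 * (β * |t|))) *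
            Real.exp (-((n : ℝ) ^ 2 / (16 * (β * |t|)) * (torusDist x y : ℝ)))

/-- **`ClassRingCorrelationLengthLowT` holds** (`norm_thermalCorr_multiFermion_ring_le_exp_add_lowT`). -/
theorem classRingCorrelationLengthLowT_holds : ClassRingCorrelationLengthLowT :=
  fun _ δ δ' σ σ' hδ hδ' t U μ β hβ hn L _ _ hP hPg x y =>
    norm_thermalCorr_multiFermion_ring_le_exp_add_lowT L δ δ' σ σ' hδ hδ' t U μ β hβ hn hP hPg x y

/-- **Thm 10⁷ (c), high temperature (PROVED below).** On the ring, if `8β|t| ≤ n` (`T ≥ 8|t|/n`,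
including `β = 0`) then for every `L`, every admissible `P`, all `x, y`:
`|⟨(P_x)† P'_y⟩_{β,L; H+P}| ≤ e^{2n} exp(-(n/2) dist(x,y))`. kind: support (PROVED). Why it might
fail: it cannot (proved). Sources: KomaTasakiPRL1992 eq. (1), Theorem (one-dimensional clause);
this cell bounds.tex Thm 10⁷; node `RingCorrelationLengthHighT` (`P = 0`). -/
@[conjecture] def ClassRingCorrelationLengthHighT : Prop :=
  ∀ (n : ℕ) (δ δ' : Fin n → Site 1) (σ σ' : Fin n → Fin 2),
    (∀ i j, δ i j = 0 ∨ δ i j = 1 ∨ δ i j = -1) → (∀ i j, δ' i j = 0 ∨ δ' i j = 1 ∨ δ' i j = -1) →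
    ∀ (t U μ β : ℝ), 0 ≤ β → 8 * (β * |t|) ≤ n →
    ∀ (L : ℕ) [NeZero L]
      (P : Matrix (Finset (Orb (FermionTorus 1 L))) (Finset (Orb (FermionTorus 1 L))) ℂ),
      P.IsHermitian → (∀ ψ : FermionTorus 1 L → ℝ, siteGauge ψ * P * siteGauge (-ψ) = P) →
      ∀ (x y : TorusSite 1 L),
        ‖(hubbardTorusWith 1 L t U μ + P).thermalCorr β
            (multiFermionD 1 δ σ L x)ᴴ (multiFermionD 1 δ' σ' L y)‖ ≤
          Real.exp (2 * n) * Real.exp (-((n : ℝ) / 2 * (torusDist x y : ℝ)))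

/-- **`ClassRingCorrelationLengthHighT` holds** (`norm_thermalCorr_multiFermion_ring_le_exp_add_highT`). -/
theorem classRingCorrelationLengthHighT_holds : ClassRingCorrelationLengthHighT :=
  fun _ δ δ' σ σ' hδ hδ' t U μ β hβ hn L _ _ hP hPg x y =>
    norm_thermalCorr_multiFermion_ring_le_exp_add_highT L δ δ' σ σ' hδ hδ' t U μ β hβ hn hP hPg x y

/-! ### The concrete Koma–Tasaki class `V({n_{x,σ}})`: arbitrary real functions of the occupations -/

/-- The `η = 1/4` line for `H(t,U) - μN + V({n_{x,σ}})`, `V = densityInteraction W` an ARBITRARY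
real function of the occupation numbers (extended / long-range / random density interactions,
site potentials, Zeeman fields), with `f, C` independent of `W`. [folklore] -/
theorem densityInteraction_etaLineEuclid {n : ℕ} (δ δ' : Fin n → Site 2) (σ σ' : Fin n → Fin 2)
    (hδ : ∀ i, δ i ∈ insert (0 : Site 2) unitSteps)
    (hδ' : ∀ i, δ' i ∈ insert (0 : Site 2) unitSteps)
    (t U μ β : ℝ) (hβ : 0 < β) (hb : β * |t| < (n : ℝ) ^ 2 / Real.pi) :
    ∃ f C : ℝ, 1 / 4 < f ∧ ∀ (L : ℕ) [NeZero L] (W : Finset (Orb (FermionTorus 2 L)) → ℝ)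
      (x y : TorusSite 2 L),
      ‖(hubbardTorusWith 2 L t U μ + densityInteraction W).thermalCorr β
          (multiFermion δ σ L x)ᴴ (multiFermion δ' σ' L y)‖ ≤
        C * ((torusDist x y : ℝ) + 1) ^ (-f) := by
  obtain ⟨f, C, hf, h⟩ := classMultiFermionEtaLineEuclid_holds n δ δ' σ σ' hδ hδ' t U μ β hβ hb
  exact ⟨f, C, hf, fun L _ W x y => h L (densityInteraction W) (isHermitian_densityInteraction W)
    (fun ψ => siteGauge_mul_densityInteraction_mul ψ W) x y⟩

/-- The ring correlation length `ξ_n ≤ 16|t|/(n²T)` for `H(t,U) - μN + V({n_{x,σ}})`, every real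
`W`. [folklore] -/
theorem densityInteraction_ringCorrelationLengthLowT {n : ℕ} (δ δ' : Fin n → Site 1)
    (σ σ' : Fin n → Fin 2)
    (hδ : ∀ i j, δ i j = 0 ∨ δ i j = 1 ∨ δ i j = -1)
    (hδ' : ∀ i j, δ' i j = 0 ∨ δ' i j = 1 ∨ δ' i j = -1)
    (t U μ β : ℝ) (hβ : 0 ≤ β) (hn : (n : ℝ) ≤ 8 * (β * |t|)) (L : ℕ) [NeZero L]
    (W : Finset (Orb (FermionTorus 1 L)) → ℝ) (x y : TorusSite 1 L) :
    ‖(hubbardTorusWith 1 L t U μ + densityInteraction W).thermalCorr β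
        (multiFermionD 1 δ σ L x)ᴴ (multiFermionD 1 δ' σ' L y)‖ ≤
      Real.exp ((n : ℝ) ^ 2 / (4 * (β * |t|))) *
        Real.exp (-((n : ℝ) ^ 2 / (16 * (β * |t|)) * (torusDist x y : ℝ))) :=
  classRingCorrelationLengthLowT_holds n δ δ' σ σ' hδ hδ' t U μ β hβ hn L (densityInteraction W)
    (isHermitian_densityInteraction W) (fun ψ => siteGauge_mul_densityInteraction_mul ψ W) x y

/-- Sanity: the member `P = 0` of the class is the plain Hubbard model, so the class nodes
specialise to the tree's `P = 0` statements (here: the ring row). [folklore] -/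
theorem ringCorrelationLengthLowT_of_class {n : ℕ} (δ δ' : Fin n → Site 1) (σ σ' : Fin n → Fin 2)
    (hδ : ∀ i j, δ i j = 0 ∨ δ i j = 1 ∨ δ i j = -1)
    (hδ' : ∀ i j, δ' i j = 0 ∨ δ' i j = 1 ∨ δ' i j = -1)
    (t U μ β : ℝ) (hβ : 0 ≤ β) (hn : (n : ℝ) ≤ 8 * (β * |t|)) (L : ℕ) [NeZero L]
    (x y : TorusSite 1 L) :
    ‖(hubbardTorusWith 1 L t U μ).thermalCorr β
        (multiFermionD 1 δ σ L x)ᴴ (multiFermionD 1 δ' σ' L y)‖ ≤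
      Real.exp ((n : ℝ) ^ 2 / (4 * (β * |t|))) *
        Real.exp (-((n : ℝ) ^ 2 / (16 * (β * |t|)) * (torusDist x y : ℝ))) := by
  have h := classRingCorrelationLengthLowT_holds n δ δ' σ σ' hδ hδ' t U μ β hβ hn L 0
    Matrix.isHermitian_zero (fun ψ => by rw [Matrix.mul_zero, Matrix.zero_mul]) x y
  simpa only [add_zero] using h

end Summit.HubbardSuperconductivity.HubbardLadder.Bounds

end
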